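import Summits.Parity.BatemanHorn.Theses.RoughValueTransport
import Literature.NumberTheory.Sieve.BatemanHornProofs
import Summits.Parity.BatemanHorn.Theorems.RoughValueTransportRoughValueLawOmegaFacts
import Summits.Parity.BatemanHorn.Theorems.RoughValueTransportSieveCalibration
import HarnessLib

/-!
# Route `RoughValueTransport`, crux `RoughValueLaw` (stmt-Parity-11390), line `increment-anchoring`:
# the crux implies its two open ratio laws (converse half of the line's normal form)

`--supports` file of the checked skeleton
`Summits/Parity/BatemanHorn/Cruxes/RoughValueLaw/Lines/increment-anchoring.lean`.  The line
`increment-anchoring` reduces the crux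
`Summit.Parity.BatemanHorn.Theses.RoughValueTransport.RoughValueLaw` (Buchstab SHAPE of the jointly
rough values of every Bateman–Horn system, constant free) to two constant-free, existence-free RATIO
laws split at depth `u = 3` — the registered stubs `stub_deepRatioLaw` (S4: `Φ_f(x,u)/Φ_f(x,U) →
((uω(u))/(Uω(U)))^k`, `3 ≤ u < U`) and `stub_shallowRatioLaw` (S5: `Φ_f(x,u)/Φ_f(x,3) →
((1+log(u−1))/(1+log 2))^k`, `2 < u < 3`), both OPEN (the crux in projective coordinates) — plus four
service stubs, all LANDED (`…RoughValueLawSieveBand`, `…MertensAlongSystem`, `…OmegaFacts`,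
`…RatioAnchoring`) and the provable linear sector (`…LinearRoughValueLaw`).

This file PROVES the registered statement `ratioLaws_of_roughValueLaw : RoughValueLaw → S4 ∧ S5`
(the converse half of the normal form `RoughValueLaw ↔ S4 ∧ S5`; the direct half
`roughValueLaw_of_ratioLaws` is the sibling file `RoughValueTransportRoughValueLawOfRatioLaws.lean`).
Argument: given the crux, fix a system `f` and a Buchstab `ω` and let `A` be its constant.  The
route's PROVED support item `SieveCalibration` (`Summit.Parity.BatemanHorn.Theorems.sieveCalibration_proof`)
applied to the rung limits `L(u) = A(uω(u))^k` gives `L(u)/u^k → (C(f)/∏deg fᵢ)e^{−kγ} > 0`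
(`IsBatemanHornSystem.hasBatemanHornConst_holds`, `IsBatemanHornSystem.natDegree_pos`), so `A ≠ 0`;
and `Vω(V) > 0` for `V > 2` because `ω = buchstabOmega ≥ ½` on `[1,∞)` (uniqueness of Buchstab's
function, `OmegaFacts.eq_buchstabOmega`, and `half_le_buchstabOmega`).  Hence the ratio of two rungs
converges to the ratio of their limits (S4), and with `uω(u) = 1 + log(u−1)` on `[2,3]`
(`stub_omegaFacts`, instantiated at `ω := buchstabOmega`) this is S5.  Everything used is PROVED in
the tree; no definition and no named fact is introduced.
-/

namespace Summit.Parity.BatemanHorn.Cruxes.RoughValueLaw.IncrementAnchoring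

open Filter Finset Polynomial
open scoped Topology BigOperators
open Literature.NumberTheory.Sieve

/-- **The crux implies the two open ratio laws S4 ∧ S5** (registered statement
`ratioLaws_of_roughValueLaw` of crux stmt-Parity-11390, line `increment-anchoring`): if for every
Bateman–Horn system and every inline-Buchstab `ω` there is `A` with
`Φ_f(x,u)(log x)^k/x → A(uω(u))^k` for all `u > 2`, then the rung RATIOS converge —
`Φ_f(x,u)/Φ_f(x,U) → ((uω(u))/(Uω(U)))^k` for `3 ≤ u < U` and
`Φ_f(x,u)/Φ_f(x,3) → ((1+log(u−1))/(1+log 2))^k` for `2 < u < 3`.  (`A ≠ 0` by the PROVED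
`SieveCalibration`; `Vω(V) > 0` by uniqueness of Buchstab's function.) [folklore] -/
theorem ratioLaws_of_roughValueLaw :
    Summit.Parity.BatemanHorn.Theses.RoughValueTransport.RoughValueLaw →
    (∀ (k : ℕ) (f : Fin k → Polynomial ℤ), IsBatemanHornSystem f → ∀ ω : ℝ → ℝ,
      ((∀ u : ℝ, 1 ≤ u → u ≤ 2 → ω u = u⁻¹) ∧ ContinuousOn ω (Set.Ici 1) ∧
        (∀ u : ℝ, 2 < u → HasDerivAt (fun t : ℝ => t * ω t) (ω (u - 1)) u)) →
      ∀ u U : ℝ, 3 ≤ u → u < U →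
        Tendsto (fun x : ℕ =>
          (((Icc 1 x).filter (fun n : ℕ => ∀ i, 0 < (f i).eval (n : ℤ) ∧
              ∀ p ∈ range ⌈(x : ℝ) ^ (((f i).natDegree : ℝ) / u)⌉₊,
                p.Prime → ¬ ((p : ℤ) ∣ (f i).eval (n : ℤ)))).card : ℝ) /
          (((Icc 1 x).filter (fun n : ℕ => ∀ i, 0 < (f i).eval (n : ℤ) ∧
              ∀ p ∈ range ⌈(x : ℝ) ^ (((f i).natDegree : ℝ) / U)⌉₊,
                p.Prime → ¬ ((p : ℤ) ∣ (f i).eval (n : ℤ)))).card : ℝ)) atTop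
          (𝓝 ((u * ω u / (U * ω U)) ^ k))) ∧
    (∀ (k : ℕ) (f : Fin k → Polynomial ℤ), IsBatemanHornSystem f →
      ∀ u : ℝ, 2 < u → u < 3 →
        Tendsto (fun x : ℕ =>
          (((Icc 1 x).filter (fun n : ℕ => ∀ i, 0 < (f i).eval (n : ℤ) ∧
              ∀ p ∈ range ⌈(x : ℝ) ^ (((f i).natDegree : ℝ) / u)⌉₊,
                p.Prime → ¬ ((p : ℤ) ∣ (f i).eval (n : ℤ)))).card : ℝ) /
          (((Icc 1 x).filter (fun n : ℕ => ∀ i, 0 < (f i).eval (n : ℤ) ∧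
              ∀ p ∈ range ⌈(x : ℝ) ^ (((f i).natDegree : ℝ) / 3)⌉₊,
                p.Prime → ¬ ((p : ℤ) ∣ (f i).eval (n : ℤ)))).card : ℝ)) atTop
          (𝓝 (((1 + Real.log (u - 1)) / (1 + Real.log 2)) ^ k))) := by
  intro hcrux
  -- the common core: ratios of two rungs converge to ratios of their limits
  have core : ∀ (k : ℕ) (f : Fin k → Polynomial ℤ), IsBatemanHornSystem f → ∀ ω : ℝ → ℝ,
      ((∀ u : ℝ, 1 ≤ u → u ≤ 2 → ω u = u⁻¹) ∧ ContinuousOn ω (Set.Ici 1) ∧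
        (∀ u : ℝ, 2 < u → HasDerivAt (fun t : ℝ => t * ω t) (ω (u - 1)) u)) →
      ∀ u U : ℝ, 2 < u → 2 < U →
        Tendsto (fun x : ℕ =>
          (((Icc 1 x).filter (fun n : ℕ => ∀ i, 0 < (f i).eval (n : ℤ) ∧
              ∀ p ∈ range ⌈(x : ℝ) ^ (((f i).natDegree : ℝ) / u)⌉₊,
                p.Prime → ¬ ((p : ℤ) ∣ (f i).eval (n : ℤ)))).card : ℝ) /
          (((Icc 1 x).filter (fun n : ℕ => ∀ i, 0 < (f i).eval (n : ℤ) ∧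
              ∀ p ∈ range ⌈(x : ℝ) ^ (((f i).natDegree : ℝ) / U)⌉₊,
                p.Prime → ¬ ((p : ℤ) ∣ (f i).eval (n : ℤ)))).card : ℝ)) atTop
          (𝓝 ((u * ω u) ^ k / (U * ω U) ^ k)) := by
    intro k f hf ω hω u U hu hU
    obtain ⟨A, hA⟩ := hcrux k f hf ω hω
    -- `Vω(V) > 0` for `V > 2`: `ω` is Buchstab's function, which is `≥ 1/2`
    have hpos : ∀ V : ℝ, 2 < V → 0 < V * ω V := by
      intro V hV
      have h1 : (1 : ℝ) ≤ V := by linarith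
      rw [OmegaFacts.eq_buchstabOmega hω.1 hω.2.1 hω.2.2 h1]
      exact mul_pos (by linarith) (lt_of_lt_of_le (by norm_num) (half_le_buchstabOmega h1))
    -- `A ≠ 0` from the PROVED `SieveCalibration`: `A ω(u)^k → (C(f)/∏deg)e^{-kγ} > 0`
    have hB : 0 < batemanHornConst f / (∏ i, ((f i).natDegree : ℝ)) *
        Real.exp (-((k : ℝ) * Real.eulerMascheroniConstant)) :=
      mul_pos (div_pos (IsBatemanHornSystem.hasBatemanHornConst_holds hf).2
        (Finset.prod_pos fun i _ => by exact_mod_cast hf.natDegree_pos i)) (Real.exp_pos _)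
    have hA0 : A ≠ 0 := by
      intro hA0
      have hcal := Summit.Parity.BatemanHorn.Theorems.sieveCalibration_proof k f hf
        (fun u : ℝ => A * (u * ω u) ^ k) ⟨3, fun u hu => hA u (by linarith)⟩
      have hzero : Tendsto (fun u : ℝ => A * (u * ω u) ^ k / u ^ k) atTop (𝓝 0) := by
        simp only [hA0, zero_mul, zero_div]
        exact tendsto_const_nhds
      exact hB.ne' (tendsto_nhds_unique hcal hzero)
    -- ratio of the two rungs
    have hne : A * (U * ω U) ^ k ≠ 0 := mul_ne_zero hA0 (pow_ne_zero k (hpos U hU).ne')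
    have hdiv := (hA u hu).div (hA U hU) hne
    have heq : A * (u * ω u) ^ k / (A * (U * ω U) ^ k) = (u * ω u) ^ k / (U * ω U) ^ k :=
      mul_div_mul_left _ _ hA0
    rw [heq] at hdiv
    refine hdiv.congr' ?_
    filter_upwards [eventually_ge_atTop 2] with x hx
    have hX : (x : ℝ) ≠ 0 := by positivity
    have hL : Real.log x ^ k ≠ 0 := pow_ne_zero k (Real.log_pos (by exact_mod_cast hx)).ne'
    rw [Pi.div_apply, div_div_div_cancel_right₀ hX, mul_div_mul_right _ _ hL]
  refine ⟨fun k f hf ω hω u U hu huU => ?_, fun k f hf u hu2 hu3 => ?_⟩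
  · have h := core k f hf ω hω u U (by linarith) (by linarith)
    rwa [← div_pow] at h
  · -- instantiate at `ω := buchstabOmega` (the crux quantifies over every Buchstab `ω`)
    have hω : (∀ u : ℝ, 1 ≤ u → u ≤ 2 → buchstabOmega u = u⁻¹) ∧
        ContinuousOn buchstabOmega (Set.Ici 1) ∧
        (∀ u : ℝ, 2 < u →
          HasDerivAt (fun t : ℝ => t * buchstabOmega t) (buchstabOmega (u - 1)) u) :=
      ⟨fun u h1 h2 => buchstabOmega_eq_inv h1 h2, continuousOn_buchstabOmega,
        fun u hu => hasDerivAt_mul_buchstabOmega hu⟩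
    have h := core k f hf buchstabOmega hω u 3 hu2 (by norm_num)
    obtain ⟨h23, -⟩ := stub_omegaFacts buchstabOmega hω
    have hu' : u * buchstabOmega u = 1 + Real.log (u - 1) := h23 u hu2.le hu3.le
    have h3 : (3 : ℝ) * buchstabOmega 3 = 1 + Real.log 2 := by
      have := h23 3 (by norm_num) le_rfl
      rwa [show (3 : ℝ) - 1 = 2 by norm_num] at this
    rwa [hu', h3, ← div_pow] at h

end Summit.Parity.BatemanHorn.Cruxes.RoughValueLaw.IncrementAnchoring
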